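import Summits.CriticalPhenomena.PercolationContinuityZ3.Theorems.PercNearOneGluingNoHeavyLowerTailSahiOneStepUniformPrelim
import Summits.CriticalPhenomena.PercolationContinuityZ3.Theorems.PercNearOneGluingNoHeavyLowerTailSahiOneStepUniformMonoA
import Summits.CriticalPhenomena.PercolationContinuityZ3.Theorems.PercNearOneGluingNoHeavyLowerTailSahiOneStepUniformShiftMeasure
import HarnessLib

/-!
# THE `(2′)` HALF FOR EVERY HAMMING THRESHOLD AT UNIFORM DENSITY, and Kahn C5 / Sahi C₃ for every threshold first slot

Support file (prover prim-ineq-prove-3 gen 21; `--supports stmt-CriticalPhenomena-4575`; memo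
`run/shared/lean/prim/prim-ineq-prove-3/PROOF-2PRIME-UNIFORM.md`, §3).  No definitions, no named facts, no sorries, no `native_decide`.

**THEOREM (`osN_threshold_nonneg_of_const`).**  For a product measure `prodBernoulli p` whose density is a constant `P ∈ (0,1)` on the block `F`,
every threshold `t` and all increasing `F`-determined events `A, B`:  `0 ≤ n(Th_t(F); A, B)`, i.e.
`Cov(1_A,1_B) ≥ μ(N_F < t)·Cov(1_A,1_B ∣ N_F < t)` — collapsing a Hamming ball to a point keeps increasing events positively correlated.

Proof (memo §3): induction on `F`; at `insert e F` an inner induction on the potential `#{S ∈ pat A : e ∉ S} + #{S ∈ pat B : e ∈ S}` either applies an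
opposite compression (`osN_compress_le`, the potential drops) or, for an `e`-dominant `A` and an `e`-dominated `B`, passes to the `H`-generated hulls
(`osN_ind_ind_hgen_le`) and applies the cross-form step lemma `osN_ind_ind_nonneg_of_cross` with the outer induction hypothesis on the sections,
MONO-A (`drift_nonneg_of_dominant`) and MONO-B (`drift_nonpos_of_dominated`).

**COROLLARY (`sahiE3_threshold_nonneg_of_const`): KAHN C5 / SAHI C₃ FOR EVERY HAMMING-THRESHOLD FIRST SLOT AT UNIFORM DENSITY** — with the `(3′)`
half `osMp_threshold_nonneg` (gen 17) and the one-step theorem `sahiE3_nonneg_of_ind` (gen 14):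
`0 ≤ E₃(1_{#(F∩ω) ≥ t}, 1_A, 1_B)` for every `F`, `t`, every density vector constant in `(0,1)` on `F`, and ALL increasing `A, B ⊆ 2^ι`.
-/

noncomputable section

namespace Summit.CriticalPhenomena.PercolationContinuityZ3.Theorems

namespace SahiOneStep

open MeasureTheory Finset
open Literature.Probability.Percolation (DeterminedBy determinedBy_iff)
open Literature.Probability.LatticeModels (prodBernoulli prodBernoulli_harris sahiE3)
open Literature.Probability.Percolation.DecisionTree (ind)
open SahiE3Sections (determinedBy_section_insert determinedBy_section_sdiff)
open scoped Classical

variable {ι : Type*} [Fintype ι]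

/-! ## Trivial cases -/

/-- **Memo Lemma 1**: if the slot is contained in `A` then `n(H;A,B) = (1 − μA)·Cov(1_B,1_H) ≥ 0`. [this work] -/
theorem osN_ind_ind_nonneg_of_slot_subset (p : ι → unitInterval) {H A B : Set (Set ι)} (hH : IsUpperSet H) (hB : IsUpperSet B)
    (hHA : H ⊆ A) : 0 ≤ osN p H (ind A) (ind B) := by
  rw [osN_ind_ind, Set.inter_eq_left.2 hHA]
  have hHarris : (prodBernoulli p).real H * (prodBernoulli p).real B ≤ (prodBernoulli p).real (H ∩ B) :=
    prodBernoulli_harris p hH hB MeasurableSet.of_discrete MeasurableSet.of_discrete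
  have hA1 : (prodBernoulli p).real A ≤ 1 := measureReal_le_one
  nlinarith [hHarris, hA1]

/-- `n(H; Ω, B) = 0`. [this work] -/
theorem osN_ind_ind_univ_left (p : ι → unitInterval) (H B : Set (Set ι)) : osN p H (ind (Set.univ : Set (Set ι))) (ind B) = 0 := by
  rw [osN_ind_ind, Set.inter_univ, probReal_univ]; ring

omit [Fintype ι] in
/-- An increasing `G`-determined event containing a configuration with no open coordinate in `G` is everything. [folklore] -/
theorem eq_univ_of_mem_of_filter_card_eq_zero {G : Finset ι} {A : Set (Set ι)} (hA : IsUpperSet A) (hAG : DeterminedBy A (↑G : Set ι))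
    {ω : Set ι} (hω : ω ∈ A) (h0 : (G.filter (· ∈ ω)).card = 0) : A = Set.univ := by
  rw [determinedBy_iff] at hAG
  refine Set.eq_univ_of_forall fun ω' => ?_
  have h1 : ω' ∪ ω ∈ A := hA Set.subset_union_right hω
  refine (hAG ω' (ω' ∪ ω) ?_).2 h1
  ext x
  simp only [Set.mem_inter_iff, Set.mem_union, Finset.mem_coe]
  constructor
  · rintro ⟨hx, hxG⟩; exact ⟨Or.inl hx, hxG⟩
  · rintro ⟨hx | hx, hxG⟩
    · exact ⟨hx, hxG⟩
    · exfalso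
      have : x ∈ G.filter (· ∈ ω) := Finset.mem_filter.2 ⟨hxG, hx⟩
      rw [Finset.card_eq_zero] at h0
      rw [h0] at this
      exact Finset.notMem_empty x this

/-- **The threshold-one slot** (memo §3, case `t = 1`): `0 ≤ n(Th_1(G); A, B)` for increasing `G`-determined `A, B` (Harris). [this work] -/
theorem osN_thresholdOne_nonneg (p : ι → unitInterval) (G : Finset ι) {A B : Set (Set ι)} (hA : IsUpperSet A) (hB : IsUpperSet B)
    (hAG : DeterminedBy A (↑G : Set ι)) (hBG : DeterminedBy B (↑G : Set ι)) :
    0 ≤ osN p {ω : Set ι | 1 ≤ (G.filter (· ∈ ω)).card} (ind A) (ind B) := by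
  set H : Set (Set ι) := {ω : Set ι | 1 ≤ (G.filter (· ∈ ω)).card} with hH
  by_cases hAH : A ⊆ H
  · by_cases hBH : B ⊆ H
    · rw [osN_ind_ind, Set.inter_eq_right.2 hAH, Set.inter_eq_right.2 hBH]
      have hHarris : (prodBernoulli p).real A * (prodBernoulli p).real B ≤ (prodBernoulli p).real (A ∩ B) :=
        prodBernoulli_harris p hA hB MeasurableSet.of_discrete MeasurableSet.of_discrete
      have hH1 : (prodBernoulli p).real H ≤ 1 := measureReal_le_one
      nlinarith [hHarris, hH1]
    · obtain ⟨ω, hωB, hωH⟩ := Set.not_subset.1 hBH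
      have h0 : (G.filter (· ∈ ω)).card = 0 := by
        rw [hH, Set.mem_setOf_eq, not_le] at hωH; omega
      rw [eq_univ_of_mem_of_filter_card_eq_zero hB hBG hωB h0, osN_comm, osN_ind_ind_univ_left]
  · obtain ⟨ω, hωA, hωH⟩ := Set.not_subset.1 hAH
    have h0 : (G.filter (· ∈ ω)).card = 0 := by
      rw [hH, Set.mem_setOf_eq, not_le] at hωH; omega
    rw [eq_univ_of_mem_of_filter_card_eq_zero hA hAG hωA h0, osN_ind_ind_univ_left]

/-- A positive threshold slot is not almost sure when the densities on the block are `< 1`. [folklore] -/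
theorem real_threshold_lt_one (p : ι → unitInterval) (F : Finset ι) (hp : ∀ i ∈ F, 0 < (p i : ℝ) ∧ (p i : ℝ) < 1) (s : ℕ) (hs : 1 ≤ s) :
    (prodBernoulli p).real {ω : Set ι | s ≤ (F.filter (· ∈ ω)).card} < 1 := by
  have h0 := real_layer_pos p F hp (Nat.zero_le F.card)
  have h1 : (prodBernoulli p).real {ω : Set ι | (F.filter (· ∈ ω)).card = 0} ≤
      (prodBernoulli p).real {ω : Set ι | (F.filter (· ∈ ω)).card < s} :=
    measureReal_mono (fun ω hω => by simp only [Set.mem_setOf_eq] at hω ⊢; omega)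
  have h2 := one_sub_real_threshold p F s
  linarith

omit [Fintype ι] in
/-- A threshold slot above the block size is empty. [folklore] -/
theorem threshold_eq_empty_of_card_lt (G : Finset ι) {s : ℕ} (hs : G.card < s) : {ω : Set ι | s ≤ (G.filter (· ∈ ω)).card} = ∅ := by
  ext ω
  simp only [Set.mem_setOf_eq, Set.mem_empty_iff_false, iff_false, not_le]
  exact lt_of_le_of_lt (Finset.card_filter_le _ _) hs

/-! ## Patterns and the potential -/

omit [Fintype ι] in
/-- For a `G`-determined event, membership of a configuration is membership of its `G`-pattern. [folklore] -/
theorem coe_filter_mem_iff {G : Finset ι} {X : Set (Set ι)} (hXG : DeterminedBy X (↑G : Set ι)) (ω : Set ι) :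
    ((G.filter (· ∈ ω) : Finset ι) : Set ι) ∈ X ↔ ω ∈ X := by
  rw [determinedBy_iff] at hXG
  refine hXG _ _ ?_
  ext x
  simp only [Set.mem_inter_iff, Finset.coe_filter, Set.mem_setOf_eq, Finset.mem_coe]
  tauto

omit [Fintype ι] in
/-- Trades of configurations agreeing on `G` agree on `G`. [folklore] -/
theorem trade_inter_eq {G : Finset ι} {α β : Set ι} (h : α ∩ ↑G = β ∩ ↑G) (a b : ι) :
    ((α \ {a}) ∪ {b}) ∩ ↑G = ((β \ {a}) ∪ {b}) ∩ ↑G := by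
  ext x
  have hx := Set.ext_iff.1 h x
  simp only [Set.mem_inter_iff, Finset.mem_coe, Set.mem_union, Set.mem_sdiff, Set.mem_singleton_iff] at hx ⊢
  constructor
  · rintro ⟨⟨hxa, hxa'⟩ | hxb, hxG⟩
    · exact ⟨Or.inl ⟨(hx.1 ⟨hxa, hxG⟩).1, hxa'⟩, hxG⟩
    · exact ⟨Or.inr hxb, hxG⟩
  · rintro ⟨⟨hxb, hxb'⟩ | hxb, hxG⟩
    · exact ⟨Or.inl ⟨(hx.2 ⟨hxb, hxG⟩).1, hxb'⟩, hxG⟩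
    · exact ⟨Or.inr hxb, hxG⟩

omit [Fintype ι] in
/-- The `G`-pattern of a configuration agrees with it on `G`. [folklore] -/
theorem coe_filter_inter_eq (G : Finset ι) (ω : Set ι) :
    ((G.filter (· ∈ ω) : Finset ι) : Set ι) ∩ ↑G = ω ∩ ↑G := by
  ext x
  simp only [Set.mem_inter_iff, Finset.coe_filter, Set.mem_setOf_eq, Finset.mem_coe]
  tauto

/-! ## The main theorem -/

/-- **THE `(2′)` HALF FOR EVERY HAMMING THRESHOLD AT UNIFORM DENSITY** (memo Theorem 1): for a product measure whose density is a constant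
`P ∈ (0,1)` on `F`, every `t` and all increasing `F`-determined `A, B`:  `0 ≤ n(Th_t(F); A, B)`, i.e.
`Cov(1_A,1_B) ≥ μ(N_F < t)·Cov(1_A,1_B ∣ N_F < t)`. [this work] -/
theorem osN_threshold_nonneg_of_const (p : ι → unitInterval) {P : ℝ} (hP0 : 0 < P) (hP1 : P < 1) (F : Finset ι)
    (hpF : ∀ i ∈ F, (p i : ℝ) = P) (t : ℕ) {A B : Set (Set ι)} (hA : IsUpperSet A) (hB : IsUpperSet B)
    (hAF : DeterminedBy A (↑F : Set ι)) (hBF : DeterminedBy B (↑F : Set ι)) :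
    0 ≤ osN p {ω : Set ι | t ≤ (F.filter (· ∈ ω)).card} (ind A) (ind B) := by
  induction F using Finset.induction_on generalizing t A B with
  | empty =>
    cases t with
    | zero => rw [threshold_zero, osN_ind_ind_univ]
    | succ t => rw [threshold_empty_succ, osN_ind_ind_empty]
  | insert e F heF ih =>
    have hpF' : ∀ i ∈ F, (p i : ℝ) = P := fun i hi => hpF i (Finset.mem_insert_of_mem hi)
    have hp01 : ∀ i ∈ F, 0 < (p i : ℝ) ∧ (p i : ℝ) < 1 := fun i hi => by rw [hpF' i hi]; exact ⟨hP0, hP1⟩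
    cases t with
    | zero => rw [threshold_zero, osN_ind_ind_univ]
    | succ t =>
      by_cases ht : t ≤ F.card
      swap
      · rw [threshold_eq_empty_of_card_lt (insert e F) (by rw [Finset.card_insert_of_notMem heF]; omega), osN_ind_ind_empty]
      rcases Nat.eq_zero_or_pos t with rfl | htpos
      · exact osN_thresholdOne_nonneg p (insert e F) hA hB hAF hBF
      -- `1 ≤ t ≤ #F`: inner induction on the potential
      have heG : e ∈ insert e F := Finset.mem_insert_self e F
      have hHup : IsUpperSet {ω : Set ι | t + 1 ≤ ((insert e F).filter (· ∈ ω)).card} := isUpperSet_threshold _ _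
      have hHG : DeterminedBy {ω : Set ι | t + 1 ≤ ((insert e F).filter (· ∈ ω)).card} (↑(insert e F) : Set ι) :=
        determinedBy_threshold _ _
      have hcoe : (↑(insert e F) : Set ι) \ {e} = ↑F := by
        ext i
        simp only [Set.mem_sdiff, Finset.coe_insert, Set.mem_insert_iff, Finset.mem_coe, Set.mem_singleton_iff]
        constructor
        · rintro ⟨h | h, hne⟩
          · exact absurd h hne
          · exact h
        · intro h
          exact ⟨Or.inr h, fun hie => heF (hie ▸ h)⟩
      suffices key : ∀ (m : ℕ) (A B : Set (Set ι)), IsUpperSet A → IsUpperSet B →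
          DeterminedBy A (↑(insert e F) : Set ι) → DeterminedBy B (↑(insert e F) : Set ι) →
          #((insert e F).powerset.filter fun S : Finset ι => (((↑S : Set ι) ∈ A) ∧ e ∉ S)) +
            #((insert e F).powerset.filter fun S : Finset ι => (((↑S : Set ι) ∈ B) ∧ e ∈ S)) = m →
          0 ≤ osN p {ω : Set ι | t + 1 ≤ ((insert e F).filter (· ∈ ω)).card} (ind A) (ind B) from
        key _ A B hA hB hAF hBF rfl
      intro m
      induction m using Nat.strong_induction_on with
      | _ m ihm =>
      intro A B hA hB hAF hBF hm
      by_cases hdom : (∀ j ∈ F, ∀ ω ∈ A, e ∉ ω → j ∈ ω → (ω \ {j}) ∪ {e} ∈ A) ∧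
          (∀ j ∈ F, ∀ ω ∈ B, e ∈ ω → j ∉ ω → (ω \ {e}) ∪ {j} ∈ B)
      · -- dominated pair: pass to the `H`-generated hulls and apply the cross-form step lemma
        obtain ⟨hdomA, hdomB⟩ := hdom
        have hA'up := isUpperSet_hgen {ω : Set ι | t + 1 ≤ ((insert e F).filter (· ∈ ω)).card} A
        have hB'up := isUpperSet_hgen {ω : Set ι | t + 1 ≤ ((insert e F).filter (· ∈ ω)).card} B
        have hA'G := determinedBy_hgen hHG hAF
        have hB'G := determinedBy_hgen hHG hBF
        refine le_trans ?_ (osN_ind_ind_hgen_le p hHup hA hB)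
        refine le_trans ?_ (osN_ind_ind_hgen_le_right p hHup hA'up hB)
        refine osN_ind_ind_nonneg_of_cross p _ _ _ e ?_ ?_ ?_ ?_ ?_ ?_ ?_ ?_
        · rw [section_insert_threshold heF]
          exact ih hpF' t (isUpperSet_section_insert hA'up e) (isUpperSet_section_insert hB'up e)
            (hcoe ▸ determinedBy_section_insert hA'G e) (hcoe ▸ determinedBy_section_insert hB'G e)
        · rw [section_sdiff_threshold heF]
          exact ih hpF' (t + 1) (isUpperSet_section_sdiff hA'up e) (isUpperSet_section_sdiff hB'up e)
            (hcoe ▸ determinedBy_section_sdiff hA'G e) (hcoe ▸ determinedBy_section_sdiff hB'G e)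
        · rw [section_insert_threshold heF]; exact real_threshold_lt_one p F hp01 t htpos
        · rw [section_sdiff_threshold heF]; exact real_threshold_lt_one p F hp01 (t + 1) (by omega)
        · exact measureReal_mono (section_sdiff_subset_section_insert hA'up e)
        · exact measureReal_mono (section_sdiff_subset_section_insert hB'up e)
        · exact drift_nonneg_of_dominant p heF ht hp01 hA'up hA'G
            (fun ω hω heω j hj hjω => dominant_hgen heG (Finset.mem_insert_of_mem hj) (fun h => heF (h ▸ hj)) (t + 1)
              (hdomA j hj) ω hω heω hjω)
        · exact drift_nonpos_of_dominated p heF t hB'up hB'G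
            (fun ω hω heω j hj hjω => dominated_hgen heG (Finset.mem_insert_of_mem hj) (fun h => heF (h ▸ hj)) (t + 1)
              (hdomB j hj) ω hω heω hjω)
            (fun ω h ω' hsub hH' => h ω' hsub hH' ω' subset_rfl hH')
      · -- a trade fails: compress along that pair of coordinates; the potential drops
        have hex : ∃ j ∈ F, (∃ ω ∈ A, e ∉ ω ∧ j ∈ ω ∧ (ω \ {j}) ∪ {e} ∉ A) ∨ (∃ ω ∈ B, e ∈ ω ∧ j ∉ ω ∧ (ω \ {e}) ∪ {j} ∉ B) := by
          rw [not_and_or] at hdom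
          rcases hdom with h | h
          · push Not at h
            obtain ⟨j, hj, ω, hω, heω, hjω, hno⟩ := h
            exact ⟨j, hj, Or.inl ⟨ω, hω, heω, hjω, hno⟩⟩
          · push Not at h
            obtain ⟨j, hj, ω, hω, heω, hjω, hno⟩ := h
            exact ⟨j, hj, Or.inr ⟨ω, hω, heω, hjω, hno⟩⟩
        obtain ⟨j, hjF, hwit⟩ := hex
        have hej : e ≠ j := fun h => heF (h ▸ hjF)
        have hjG : j ∈ insert e F := Finset.mem_insert_of_mem hjF
        have hpej : p e = p j := Subtype.ext (by rw [hpF e heG, hpF j hjG])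
        -- the compressions of `A` towards `e` and of `B` towards `j`
        -- (introduced as opaque sets, characterised by their membership)
        obtain ⟨CA, hCAdef⟩ : ∃ CA : Set (Set ι), CA = {ω : Set ι | (ω ∈ A ∧ {x : ι | Equiv.swap e j x ∈ ω} ∈ A) ∨
          (e ∈ ω ∧ j ∉ ω ∧ (ω ∈ A ∨ {x : ι | Equiv.swap e j x ∈ ω} ∈ A))} := ⟨_, rfl⟩
        obtain ⟨CB, hCBdef⟩ : ∃ CB : Set (Set ι), CB = {ω : Set ι | (ω ∈ B ∧ {x : ι | Equiv.swap e j x ∈ ω} ∈ B) ∨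
          (j ∈ ω ∧ e ∉ ω ∧ (ω ∈ B ∨ {x : ι | Equiv.swap e j x ∈ ω} ∈ B))} := ⟨_, rfl⟩
        have hCA : ∀ ω : Set ι, ω ∈ CA ↔ (ω ∈ A ∧ {x : ι | Equiv.swap e j x ∈ ω} ∈ A) ∨
            (e ∈ ω ∧ j ∉ ω ∧ (ω ∈ A ∨ {x : ι | Equiv.swap e j x ∈ ω} ∈ A)) := fun ω => by rw [hCAdef]; exact Iff.rfl
        have hCB : ∀ ω : Set ι, ω ∈ CB ↔ (ω ∈ B ∧ {x : ι | Equiv.swap e j x ∈ ω} ∈ B) ∨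
            (j ∈ ω ∧ e ∉ ω ∧ (ω ∈ B ∨ {x : ι | Equiv.swap e j x ∈ ω} ∈ B)) := fun ω => by rw [hCBdef]; exact Iff.rfl
        have hCB' : ∀ ω : Set ι, ω ∈ CB ↔ (ω ∈ B ∧ {x : ι | Equiv.swap j e x ∈ ω} ∈ B) ∨
            (j ∈ ω ∧ e ∉ ω ∧ (ω ∈ B ∨ {x : ι | Equiv.swap j e x ∈ ω} ∈ B)) := by
          intro ω; rw [Equiv.swap_comm j e]; exact hCB ω
        have hCAup : IsUpperSet CA := isUpperSet_of_compress hej hA hCA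
        have hCBup : IsUpperSet CB := isUpperSet_of_compress hej.symm hB hCB'
        have hCAG : DeterminedBy CA (↑(insert e F) : Set ι) := determinedBy_of_compress heG hjG hAF hCA
        have hCBG : DeterminedBy CB (↑(insert e F) : Set ι) := determinedBy_of_compress hjG heG hBF hCB'
        -- the potential drops
        have hsubA := filter_pat_compress_subset (G := insert e F) hCA
        have hsubB := filter_pat_compress_subset' (G := insert e F) hCB
        have hlt : #((insert e F).powerset.filter fun S : Finset ι => (((↑S : Set ι) ∈ CA) ∧ e ∉ S)) +
            #((insert e F).powerset.filter fun S : Finset ι => (((↑S : Set ι) ∈ CB) ∧ e ∈ S)) < m := by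
          rcases hwit with ⟨ω, hωA, heω, hjω, hno⟩ | ⟨ω, hωB, heω, hjω, hno⟩
          · have hS₀e : e ∉ ((↑((insert e F).filter (· ∈ ω)) : Set ι)) := fun h => by
              rw [Finset.mem_coe, Finset.mem_filter] at h; exact heω h.2
            have hS₀j : j ∈ ((↑((insert e F).filter (· ∈ ω)) : Set ι)) := by
              rw [Finset.mem_coe, Finset.mem_filter]; exact ⟨hjG, hjω⟩
            have hS₀A : (insert e F).filter (· ∈ ω) ∈ (insert e F).powerset.filter (fun S : Finset ι => (((↑S : Set ι) ∈ A) ∧ e ∉ S)) := by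
              rw [Finset.mem_filter]
              exact ⟨Finset.mem_powerset.2 (Finset.filter_subset _ _), (coe_filter_mem_iff hAF ω).2 hωA,
                fun h => heω (Finset.mem_filter.1 h).2⟩
            have hS₀C : (insert e F).filter (· ∈ ω) ∉ (insert e F).powerset.filter (fun S : Finset ι => (((↑S : Set ι) ∈ CA) ∧ e ∉ S)) := by
              intro h
              rw [Finset.mem_filter] at h
              rcases (hCA _).1 h.2.1 with ⟨_, hσ⟩ | ⟨he', _, _⟩
              · rw [swapSet_eq_trade hS₀e hS₀j] at hσ
                have htr := trade_inter_eq (coe_filter_inter_eq (insert e F) ω) j e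
                exact hno (((determinedBy_iff _ _).1 hAF _ _ htr).1 hσ)
              · exact hS₀e he'
            have h1 := Finset.card_lt_card ((Finset.ssubset_iff_of_subset hsubA).2 ⟨_, hS₀A, hS₀C⟩)
            have h2 := Finset.card_le_card hsubB
            omega
          · have hS₀e : e ∈ ((↑((insert e F).filter (· ∈ ω)) : Set ι)) := by
              rw [Finset.mem_coe, Finset.mem_filter]; exact ⟨heG, heω⟩
            have hS₀j : j ∉ ((↑((insert e F).filter (· ∈ ω)) : Set ι)) := fun h => by
              rw [Finset.mem_coe, Finset.mem_filter] at h; exact hjω h.2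
            have hS₀B : (insert e F).filter (· ∈ ω) ∈ (insert e F).powerset.filter (fun S : Finset ι => (((↑S : Set ι) ∈ B) ∧ e ∈ S)) := by
              rw [Finset.mem_filter]
              exact ⟨Finset.mem_powerset.2 (Finset.filter_subset _ _), (coe_filter_mem_iff hBF ω).2 hωB,
                Finset.mem_filter.2 ⟨heG, heω⟩⟩
            have hS₀C : (insert e F).filter (· ∈ ω) ∉ (insert e F).powerset.filter (fun S : Finset ι => (((↑S : Set ι) ∈ CB) ∧ e ∈ S)) := by
              intro h
              rw [Finset.mem_filter] at h
              rcases (hCB _).1 h.2.1 with ⟨_, hσ⟩ | ⟨_, he', _⟩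
              · rw [swapSet_eq_trade' hS₀e hS₀j] at hσ
                have htr := trade_inter_eq (coe_filter_inter_eq (insert e F) ω) e j
                exact hno (((determinedBy_iff _ _).1 hBF _ _ htr).1 hσ)
              · exact he' hS₀e
            have h1 := Finset.card_le_card hsubA
            have h2 := Finset.card_lt_card ((Finset.ssubset_iff_of_subset hsubB).2 ⟨_, hS₀B, hS₀C⟩)
            omega
        calc (0 : ℝ) ≤ osN p {ω : Set ι | t + 1 ≤ ((insert e F).filter (· ∈ ω)).card} (ind CA) (ind CB) :=
              ihm _ hlt CA CB hCAup hCBup hCAG hCBG rfl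
          _ ≤ osN p {ω : Set ι | t + 1 ≤ ((insert e F).filter (· ∈ ω)).card} (ind A) (ind B) :=
              osN_compress_le p heG hjG hpej (t + 1) hAF hBF hCA hCB

/-- **KAHN C5 / SAHI C₃ FOR EVERY HAMMING-THRESHOLD FIRST SLOT AT UNIFORM DENSITY** (memo Corollary 2).  For every block `F`, every `t`,
every density vector equal to a constant `P ∈ (0,1)` on `F`, and ALL increasing events `A, B ⊆ 2^ι`:  `0 ≤ E₃(1_{#(F∩ω) ≥ t}, 1_A, 1_B)`.
The `(3′)` half is `osMp_threshold_nonneg` (gen 17, every density); the `(2′)` half is `osN_threshold_nonneg_of_const`. [this work] -/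
theorem sahiE3_threshold_nonneg_of_const (p : ι → unitInterval) {P : ℝ} (hP0 : 0 < P) (hP1 : P < 1) (F : Finset ι)
    (hpF : ∀ i ∈ F, (p i : ℝ) = P) (t : ℕ) {A B : Set (Set ι)} (hA : IsUpperSet A) (hB : IsUpperSet B) :
    0 ≤ sahiE3 (prodBernoulli p) {ω : Set ι | t ≤ (F.filter (· ∈ ω)).card} A B :=
  sahiE3_nonneg_of_ind p (determinedBy_threshold F t)
    (fun _ _ hA' hB' hAF hBF => osMp_threshold_nonneg p F t hA' hB' hAF hBF)
    (fun _ _ hA' hB' hAF hBF => osN_threshold_nonneg_of_const p hP0 hP1 F hpF t hA' hB' hAF hBF) hA hB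

end SahiOneStep

end Summit.CriticalPhenomena.PercolationContinuityZ3.Theorems
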